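import Literature.Analysis.FluidPDE.EnergySpaceTorusHilbertBasisProofs
import Literature.Analysis.UnboundedOperators.DiagonalOperatorCompact
import HarnessLib

/-!
# The square root `(1 + A)^{-1/2}` of the Stokes resolvent on the energy space of the flat torus

Topic `Literature/Analysis/FluidPDE`; companion of `StokesTorusResolvent.lean` (the resolvent
`(1 + A)⁻¹` of the Stokes operator `A = Torus.stokesOperatorH d : H →ₗ.[ℝ] H` on the mean-zero
solenoidal energy space `H = Torus.energySpace d`) and of `EnergySpaceTorusHilbertBasisProofs.lean`
(`exists_hilbertBasis_stokes_holds`: `A` is the maximal diagonal operator `b.diagonalPMap m` in a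
Hilbert basis `b` of Stokes modes, with symbol `0 < m i = 4π²|kᵢ|² → ∞`).

**Theorems** (no definitions, no named facts):

* `exists_sqrtResolvent_diagonalPMap` — for a Hilbert basis `b` of a real Hilbert space and a
  non-negative symbol `m` with `m i → ∞` along the cofinite filter, the bounded diagonal operator
  `S = b.diagonalCLM ((1 + m)^{-1/2})` is an injective, self-adjoint, compact contraction whose
  square `R = S ∘ S = b.diagonalCLM ((1 + m)⁻¹)` is the two-sided inverse of `1 + b.diagonalPMap m`
  (`R v ∈ D(diag m)`, `R v + diag(m) (R v) = v` for every `v`, `R (v + diag(m) v) = v` on the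
  domain), and which satisfies the FRAME IDENTITY `‖z‖² = ‖S z‖² + ⟪diag(m) (S z), S z⟫` whenever
  `S z ∈ D(diag m)` (coefficientwise `1 = (1 + m)⁻¹ + m (1 + m)⁻¹`) (Reed–Simon I, §VIII.3
  Proposition 1 and Thm. VIII.2, VIII.4–VIII.6 (functional calculus of self-adjoint multiplication
  operators: `(1 + m)^{-1/2}` is multiplication by the bounded real symbol); Halmos, *A Hilbert
  Space Problem Book*, Problems 61–63, 171 (diagonal operators: norm, adjoint, compactness));
* `Torus.exists_stokesSqrtResolvent` — the operator `S = (1 + A)^{-1/2}` on `H = Torus.energySpace d`: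
  an injective self-adjoint compact contraction `S : H →L[ℝ] H`, diagonal with symbol
  `(1 + 4π²|k|²)^{-1/2}` in the Stokes eigenbasis, whose square `R = S ∘ S = (1 + A)⁻¹` satisfies
  `R v ∈ D(A)`, `R v + A (R v) = v` (`v ∈ H`), `R (v + A v) = v` (`v ∈ D(A)`), together with the
  frame identity `‖z‖² = ‖S z‖² + ⟪A (S z), S z⟫` for `S z ∈ D(A)`: the norm `‖S⁻¹ v‖` is the
  `V`-norm `(‖v‖² + ⟪A v, v⟫)^{1/2} = (‖v‖²_{L²} + ‖∇v‖²_{L²})^{1/2}` of Constantin–Foias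
  (1988, Ch. 4, (4.4)–(4.7), (4.11)–(4.13): `V = D(A^{1/2})`, `A` positive self-adjoint with compact
  inverse, `A w_j = λ_j w_j`, `λ_j → ∞`; Temam 1977, Ch. I §2.6).

The second is the first applied to the eigenbasis of `exists_hilbertBasis_stokes_holds`, after
rewriting `Torus.stokesOperatorH d = b.diagonalPMap m`.  `S` is the smoothing isomorphism
`H → V = D(A^{1/2})` by which the Navier–Stokes strong-solution semiflow is conjugated to a smooth
semiflow in the `V`-frame.  Deliberately NOT here: a named `def` of `S` (the existential statement is
all that is consumed), the identification `D(A^{1/2}) = H ∩ H¹`, fractional powers `A^α` in general.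

## References

* P. Constantin, C. Foias, *Navier–Stokes Equations* (Univ. Chicago Press, 1988), Ch. 4,
  (4.4)–(4.7), (4.11)–(4.13). [ConstantinFoiasNSE1988]
* M. Reed, B. Simon, *Methods of Modern Mathematical Physics I* (Academic Press, 1980), §VIII.3
  Proposition 1, Thm. VIII.2, Thm. VIII.4–VIII.6, Thm. VI.12–VI.13. [ReedSimonI1980]
* P. R. Halmos, *A Hilbert Space Problem Book*, 2nd ed. (Springer, 1982), Problems 61–63, 171.
-/

noncomputable section

open Filter
open scoped InnerProductSpace ENNReal Topology

namespace Literature.Analysis.FluidPDE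

/-! ### The square root of the resolvent of a non-negative diagonal operator -/

/-- **Square root `(1 + diag m)^{-1/2}` of the resolvent of a non-negative diagonal operator with
divergent symbol.**  Let `b` be a Hilbert basis of a real Hilbert space `H` and `m : ι → ℝ` a
symbol with `0 ≤ m i` and `m i → ∞` along the cofinite filter.  Then there are bounded operators
`S R : H →L[ℝ] H` (namely `S = b.diagonalCLM ((1 + m)^{-1/2})`, the diagonal operator with the
bounded symbol `√((1 + m i)⁻¹) ∈ (0, 1]`, and `R = S ∘ S`, the diagonal operator with symbol
`(1 + m i)⁻¹`) such that `S` is injective, of norm `≤ 1`, self-adjoint and compact, `R` maps `H`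
into the maximal domain of `b.diagonalPMap m` and inverts `1 + b.diagonalPMap m` on both sides
(`R v + diag(m) (R v) = v` for all `v ∈ H`, `R (v + diag(m) v) = v` for all `v ∈ D(diag m)`), and
the frame identity `‖z‖² = ‖S z‖² + ⟪diag(m) (S z), S z⟫` holds whenever `S z ∈ D(diag m)`
(Parseval in the basis `b`: coefficientwise `|c|² = (1 + m)⁻¹ |c|² + m (1 + m)⁻¹ |c|²`).
(Reed–Simon I, §VIII.3 Proposition 1 with Thm. VIII.2 and the functional calculus Thm. VIII.4–VIII.6:
`(1 + m)^{-1/2}` of the self-adjoint multiplication operator by `m` is multiplication by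
`(1 + m)^{-1/2}`; compactness since `(1 + m i)^{-1/2} → 0`, Thm. VI.12–VI.13 / Halmos Problem 171;
norm and adjoint of a diagonal operator, Halmos Problems 61–63.)
[cite: ReedSimonI1980, §VIII.3 Proposition 1, Thm. VIII.2, Thm. VIII.4–VIII.6] -/
theorem exists_sqrtResolvent_diagonalPMap {ι H : Type*} [NormedAddCommGroup H]
    [InnerProductSpace ℝ H] [CompleteSpace H] (b : HilbertBasis ι ℝ H) {m : ι → ℝ}
    (hpos : ∀ i, 0 ≤ m i) (htend : Tendsto m cofinite atTop) :
    ∃ S R : H →L[ℝ] H, S.comp S = R ∧ Function.Injective S ∧ ‖S‖ ≤ 1 ∧ IsSelfAdjoint S ∧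
      IsCompactOperator S ∧
      (∀ v : H, ∃ hv : R v ∈ (b.diagonalPMap m).domain, R v + b.diagonalPMap m ⟨R v, hv⟩ = v) ∧
      (∀ (v : H) (hv : v ∈ (b.diagonalPMap m).domain), R (v + b.diagonalPMap m ⟨v, hv⟩) = v) ∧
      (∀ (z : H) (hz : S z ∈ (b.diagonalPMap m).domain),
        ‖z‖ ^ 2 = ‖S z‖ ^ 2 + ⟪b.diagonalPMap m ⟨S z, hz⟩, S z⟫_ℝ) := by
  -- the symbols `(1 + m i)⁻¹ ∈ (0, 1]` of `R` and `√((1 + m i)⁻¹) ∈ (0, 1]` of `S`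
  have hm1 : ∀ i, 0 < 1 + m i := fun i => add_pos_of_pos_of_nonneg one_pos (hpos i)
  have hr0 : ∀ i, 0 < (1 + m i)⁻¹ := fun i => inv_pos.2 (hm1 i)
  have hr1 : ∀ i, (1 + m i)⁻¹ ≤ 1 := fun i =>
    inv_le_one_of_one_le₀ (le_add_of_nonneg_right (hpos i))
  have hs0 : ∀ i, 0 < Real.sqrt ((1 + m i)⁻¹) := fun i => Real.sqrt_pos.2 (hr0 i)
  have hs1 : ∀ i, ‖Real.sqrt ((1 + m i)⁻¹)‖ ≤ 1 := fun i => by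
    rw [Real.norm_of_nonneg (Real.sqrt_nonneg _)]
    exact Real.sqrt_le_one.2 (hr1 i)
  have hss : ∀ i, Real.sqrt ((1 + m i)⁻¹) * Real.sqrt ((1 + m i)⁻¹) = (1 + m i)⁻¹ := fun i =>
    Real.mul_self_sqrt (hr0 i).le
  have hsmem : Memℓp (fun i => Real.sqrt ((1 + m i)⁻¹)) ∞ :=
    memℓp_infty ⟨1, by rintro _ ⟨i, rfl⟩; exact hs1 i⟩
  obtain ⟨s, hs⟩ : ∃ s : lp (fun _ : ι => ℝ) ∞, ∀ i, s i = Real.sqrt ((1 + m i)⁻¹) :=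
    ⟨⟨fun i => Real.sqrt ((1 + m i)⁻¹), hsmem⟩, fun _ => rfl⟩
  -- the symbol `m i * (1 + m i)⁻¹ ∈ [0, 1)` of `diag(m) ∘ R`
  have hmr : Memℓp (fun i => m i * (1 + m i)⁻¹) ∞ := by
    refine memℓp_infty ⟨1, ?_⟩
    rintro _ ⟨i, rfl⟩
    dsimp only
    rw [Real.norm_of_nonneg (mul_nonneg (hpos i) (hr0 i).le), ← div_eq_mul_inv,
      div_le_one (hm1 i)]
    exact le_add_of_nonneg_left zero_le_one
  -- coordinates of `S` and of `R = S ∘ S`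
  have hcoordS : ∀ (v : H) (i : ι),
      b.repr (b.diagonalCLM s v) i = Real.sqrt ((1 + m i)⁻¹) * b.repr v i := fun v i => by
    rw [b.diagonalCLM_apply_repr, hs]
  have hcoordR : ∀ (v : H) (i : ι),
      b.repr ((b.diagonalCLM s).comp (b.diagonalCLM s) v) i = (1 + m i)⁻¹ * b.repr v i :=
    fun v i => by rw [ContinuousLinearMap.comp_apply, hcoordS, hcoordS, ← mul_assoc, hss]
  -- `R v ∈ D(diag m)`
  have hdom : ∀ v : H, (b.diagonalCLM s).comp (b.diagonalCLM s) v ∈ (b.diagonalPMap m).domain :=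
    fun v => by
    rw [HilbertBasis.diagonalPMap_domain, HilbertBasis.mem_diagonalDomain_iff]
    have h := hmr.infty_mul_left (lp.memℓp (b.repr v))
    refine (congrArg (Memℓp · 2) (funext fun i => ?_)).mp h
    dsimp only
    rw [hcoordR, mul_assoc]
  refine ⟨b.diagonalCLM s, (b.diagonalCLM s).comp (b.diagonalCLM s), rfl, ?_, ?_, ?_, ?_,
    fun v => ⟨hdom v, ?_⟩, fun v hv => ?_, fun z hz => ?_⟩
  · -- injective: the symbol does not vanish
    intro x y hxy
    apply b.repr.injective
    ext i
    have h := congrArg (fun z => b.repr z i) hxy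
    simp only [hcoordS] at h
    exact mul_left_cancel₀ (hs0 i).ne' h
  · -- `‖S‖ ≤ ‖s‖_∞ ≤ 1`
    refine (b.norm_diagonalCLM_le s).trans (lp.norm_le_of_forall_le zero_le_one fun i => ?_)
    rw [hs]
    exact hs1 i
  · -- self-adjoint: the symbol is real
    have hstar : star s = s := lp.ext (funext fun i => star_trivial (s i))
    rw [IsSelfAdjoint, ContinuousLinearMap.star_eq_adjoint, b.adjoint_diagonalCLM, hstar]
  · -- compact: the symbol tends to zero
    refine b.isCompactOperator_diagonalCLM_of_tendsto_zero s ?_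
    have h : Tendsto (fun i => Real.sqrt ((1 + m i)⁻¹)) cofinite (𝓝 0) := by
      rw [← Real.sqrt_zero]
      exact ((tendsto_atTop_add_const_left _ 1 htend).inv_tendsto_atTop).sqrt
    refine (tendsto_zero_iff_norm_tendsto_zero.mp h).congr fun i => ?_
    rw [hs]
  · -- `R v + diag(m) (R v) = v`, coefficientwise `(1 + m i) (1 + m i)⁻¹ c = c`
    apply b.repr.injective
    ext i
    rw [map_add, lp.coeFn_add, Pi.add_apply, HilbertBasis.repr_diagonalPMap_apply]
    change b.repr ((b.diagonalCLM s).comp (b.diagonalCLM s) v) i +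
      m i * b.repr ((b.diagonalCLM s).comp (b.diagonalCLM s) v) i = b.repr v i
    rw [hcoordR]
    calc (1 + m i)⁻¹ * b.repr v i + m i * ((1 + m i)⁻¹ * b.repr v i)
        = (1 + m i) * (1 + m i)⁻¹ * b.repr v i := by ring
      _ = b.repr v i := by rw [mul_inv_cancel₀ (hm1 i).ne', one_mul]
  · -- `R (v + diag(m) v) = v`, coefficientwise `(1 + m i)⁻¹ (1 + m i) c = c`
    apply b.repr.injective
    ext i
    rw [hcoordR, map_add, lp.coeFn_add, Pi.add_apply, HilbertBasis.repr_diagonalPMap_apply]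
    change (1 + m i)⁻¹ * (b.repr v i + m i * b.repr v i) = b.repr v i
    calc (1 + m i)⁻¹ * (b.repr v i + m i * b.repr v i)
        = (1 + m i)⁻¹ * (1 + m i) * b.repr v i := by ring
      _ = b.repr v i := by rw [inv_mul_cancel₀ (hm1 i).ne', one_mul]
  · -- the frame identity, by Parseval: `|c|² = (1 + m)⁻¹ |c|² + m (1 + m)⁻¹ |c|²` coefficientwise
    have h0 := lp.hasSum_inner (𝕜 := ℝ) (b.repr z) (b.repr z)
    have h1 := lp.hasSum_inner (𝕜 := ℝ) (b.repr (b.diagonalCLM s z)) (b.repr (b.diagonalCLM s z))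
    have h2 := lp.hasSum_inner (𝕜 := ℝ) (b.repr (b.diagonalPMap m ⟨b.diagonalCLM s z, hz⟩))
      (b.repr (b.diagonalCLM s z))
    rw [b.repr.inner_map_map, real_inner_self_eq_norm_sq] at h0 h1
    rw [b.repr.inner_map_map] at h2
    have h12 := h1.add h2
    have hfun : (fun i => ⟪b.repr (b.diagonalCLM s z) i, b.repr (b.diagonalCLM s z) i⟫_ℝ +
        ⟪b.repr (b.diagonalPMap m ⟨b.diagonalCLM s z, hz⟩) i, b.repr (b.diagonalCLM s z) i⟫_ℝ) =
        fun i => ⟪b.repr z i, b.repr z i⟫_ℝ := by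
      funext i
      rw [HilbertBasis.repr_diagonalPMap_apply]
      change ⟪b.repr (b.diagonalCLM s z) i, b.repr (b.diagonalCLM s z) i⟫_ℝ +
        ⟪m i * b.repr (b.diagonalCLM s z) i, b.repr (b.diagonalCLM s z) i⟫_ℝ =
        ⟪b.repr z i, b.repr z i⟫_ℝ
      simp only [hcoordS, RCLike.inner_apply, RCLike.conj_to_real]
      calc Real.sqrt ((1 + m i)⁻¹) * b.repr z i * (Real.sqrt ((1 + m i)⁻¹) * b.repr z i) +
            Real.sqrt ((1 + m i)⁻¹) * b.repr z i *
              (m i * (Real.sqrt ((1 + m i)⁻¹) * b.repr z i))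
          = (1 + m i) * (Real.sqrt ((1 + m i)⁻¹) * Real.sqrt ((1 + m i)⁻¹)) *
              (b.repr z i * b.repr z i) := by ring
        _ = b.repr z i * b.repr z i := by rw [hss, mul_inv_cancel₀ (hm1 i).ne', one_mul]
    rw [hfun] at h12
    exact h0.unique h12

/-! ### The square root of the Stokes resolvent on the torus -/

namespace Torus

/-- **The operator `(1 + A)^{-1/2}` on the energy space of the flat torus.**  For the Stokes
operator `A = Torus.stokesOperatorH d` on `H = Torus.energySpace d` (mean-zero solenoidal `L²`
vector fields on `T^d`) there are bounded operators `S R : H →L[ℝ] H` — `S = (1 + A)^{-1/2}`,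
diagonal with symbol `(1 + 4π²|k|²)^{-1/2}` in the Stokes eigenbasis, and its square
`R = S ∘ S = (1 + A)⁻¹` — such that `S` is injective, of norm `≤ 1`, self-adjoint and compact,
`R` maps `H` into `D(A)` with `R v + A (R v) = v` for every `v ∈ H` and `R (v + A v) = v` for every
`v ∈ D(A)`, and the frame identity `‖z‖² = ‖S z‖² + ⟪A (S z), S z⟫` holds whenever `S z ∈ D(A)`;
i.e. `S` is an isomorphism of `H` onto `V = D(A^{1/2})` carrying the norm of `H` to the `V`-norm
`(‖v‖² + ⟪A v, v⟫)^{1/2} = (‖v‖²_{L²} + ‖∇v‖²_{L²})^{1/2}` (Constantin–Foias 1988, Ch. 4,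
(4.4)–(4.7) and (4.11)–(4.13): `A` is a positive self-adjoint operator with compact inverse,
`A w_j = λ_j w_j`, `0 < λ_1 ≤ λ_2 ≤ ⋯ → ∞`, `V = D(A^{1/2})`; Temam 1977, Ch. I §2.6).  Proof: the
tree's eigenbasis `exists_hilbertBasis_stokes_holds` (`A = b.diagonalPMap m`, `0 < m i → ∞`) and
`exists_sqrtResolvent_diagonalPMap`.
[cite: ConstantinFoiasNSE1988, Ch. 4 (4.4)–(4.7), (4.11)–(4.13)] -/
theorem exists_stokesSqrtResolvent (d : Type*) [Fintype d] [DecidableEq d] :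
    ∃ S R : FunctionSpaces.Torus.energySpace d →L[ℝ] FunctionSpaces.Torus.energySpace d,
      S.comp S = R ∧ Function.Injective S ∧ ‖S‖ ≤ 1 ∧ IsSelfAdjoint S ∧ IsCompactOperator S ∧
      (∀ v : FunctionSpaces.Torus.energySpace d, ∃ hv : R v ∈ (stokesOperatorH d).domain,
        R v + stokesOperatorH d ⟨R v, hv⟩ = v) ∧
      (∀ (v : FunctionSpaces.Torus.energySpace d) (hv : v ∈ (stokesOperatorH d).domain),
        R (v + stokesOperatorH d ⟨v, hv⟩) = v) ∧
      (∀ (z : FunctionSpaces.Torus.energySpace d) (hz : S z ∈ (stokesOperatorH d).domain),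
        ‖z‖ ^ 2 = ‖S z‖ ^ 2 + ⟪stokesOperatorH d ⟨S z, hz⟩, S z⟫_ℝ) := by
  obtain ⟨ι, b, m, -, hpos, htend, hA, -⟩ := exists_hilbertBasis_stokes_holds (d := d)
  rw [hA]
  exact exists_sqrtResolvent_diagonalPMap b (fun i => (hpos i).le) htend

end Torus

end Literature.Analysis.FluidPDE
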